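import Summits.BirchSwinnertonDyer.BirchSwinnertonDyer.Theorems.ErratumRoadFiveRamNoErratumDataKolyvaginTam
import HarnessLib

/-!
# Route `ErratumRoadFive` (rung K2, `p ≥ 5`): the two CHILDREN of crux `RamNoErratumDataAtFive` (REST‴, item 19624) in the
# Tamagawa-SLACK currency — the torsion branch (T) `Rest3TorsionBranchAtFive` (item 19702) BY NAME and the (NW) child's registered
# off-Locus stub `stub_nw_offLocus` (item 19703) VERBATIM, each from the published facts + JSW17 Thm. 3.3.1-mult + ONE odd
# Tamagawa-slack Heegner datum per pair (cell `bsd-stepL`, seat `bsd-stepL-rest-p2` g2; companion of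
# `ErratumRoadFiveRamNoErratumDataKolyvaginTam.lean` §2, whose pair-level packaging `openInputOnTreeAt_of_exists_slackDatum_of_thm331Mult` it applies)

HONEST FRAMING: THEOREMS ONLY (no definition, no named fact, no `sorry`); CONDITIONAL on every displayed binder; `hS` is a per-pair
CERTIFICATE currency (one odd Heegner datum `(K, Dt, H, ι, P)` with `d_K < −4`, `p ∤ c`, `P` non-torsion, `ord_p [E(K):ℤP] ≤ ord_p ∏ c_ℓ(E)`;
false class-wide wherever `Ш(E)[p] ≠ 0`), attested on the 22 480 REST⁗ pairs `N < 5·10⁵` by the seat's census (HOME/rest/SLACK-CENSUS.md);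
nothing is booked; BSD is proved for no pair; no census word moves (T7).

* `rest3TorsionBranchAtFive_of_slackData_of_thm331Mult` ∕ `…_of_publishedInputsFive_of_slackData` — (T) BY NAME ⟸ `hS` on the (T) rows
  (a non-zero `p`-torsion point in `E(ℚ_p)`: `p` split, `p ∣ c_p`, where the classical index certificate is impossible).
* `nwOffLocus_of_slackData_of_thm331Mult` ∕ `…_of_publishedInputsFive_of_slackData` — `stub_nw_offLocus` VERBATIM ⟸ `hS` on the
  (NW) ∩ off-Locus rows; the slack twin of nw1's `stub_nw_offLocus_of_kolyvaginTamFramesHL_of_thm331Mult` (p462313).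

References: [cite: Gross1991, (1.1), Thm. 1.3, (2.2)] [cite: JetchevSkinnerWan2017, Thm. 3.3.1, §7.4.1 (pp. 30–31)]
[cite: Skinner2016PacificMC, Thm. C (§1)] [cite: Castella2018Erratum, Thm. 1.1 (iii)–(iv)].
-/

set_option autoImplicit false
-- the Theorems namespace of this sub repeats the summit name by design (D-0017 nested layout)
set_option linter.dupNamespace false

noncomputable section

open scoped Classical

namespace Summit.BirchSwinnertonDyer.BirchSwinnertonDyer.Theorems

open WeierstrassCurve Literature.NumberTheory.EllipticCurves
  Literature.NumberTheory.EllipticCurves.ModularForms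
  Literature.NumberTheory.EllipticCurves.Rank1Residual
  Summit.BirchSwinnertonDyer.Rank1Residual Summit.BirchSwinnertonDyer.Rank1Residual.X11b
  Summit.BirchSwinnertonDyer.Rank1Residual.X11b.Three.Koly
  Summit.BirchSwinnertonDyer.BirchSwinnertonDyer.Theses.ErratumRoadFive

/-! ## The two children of the crux in the slack currency: (T) `Rest3TorsionBranchAtFive` (item 19702)
and the (NW) child's off-Locus stub `stub_nw_offLocus` (item 19703) -/

/-- **The torsion branch (T) `Rest3TorsionBranchAtFive` (item 19702) BY NAME ⟸ Tamagawa-slack Heegner data on the (T) rows.** The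
published named facts, JSW17 Thm. 3.3.1-mult (`h331`) and `hS`: at every X11b pair with `p ≥ 5`, `ρ̄` onto, a (ram) witness and a
NON-ZERO `p`-torsion point in `E(ℚ_p)` (so `p` is split with `p ∣ c_p`, `ord_p ∏ c_ℓ ≥ 1`; cw 3 687 pairs `N < 5·10⁵`), ONE odd Heegner
datum with `d_K < −4`, `p ∤ c`, non-torsion Heegner point and `ord_p [E(K):ℤP] ≤ ord_p ∏_ℓ c_ℓ(E)`. On (T) the classical index
certificate is impossible (`p ∣ c_p ∣ [E(K):ℤy_K]`); the slack inequality asks only that the index carry no MORE `p` than `∏ c_ℓ` —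
BSD-predicted exactly when `Ш(E)[p] = 0 = Ш(E^{d_K})[p]`, and attested pair by pair by the seat's census. CONDITIONAL; `hS` is a per-pair
certificate currency; nothing booked. [cite: Gross1991, (1.1), Thm. 1.3, (2.2)] [cite: JetchevSkinnerWan2017, Thm. 3.3.1, §7.4.1]
[cite: Skinner2016PacificMC, Thm. C (§1)] [cite: Castella2018Erratum, Thm. 1.1 (iv)] -/
theorem rest3TorsionBranchAtFive_of_slackData_of_thm331Mult
    (hGZ : ∀ (N : ℕ) [NeZero N] (W : WeierstrassCurve ℚ) (K : Type) [Field K] [NumberField K],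
      gross_zagier N W K)
    (hKo : ∀ (N : ℕ) [NeZero N] (W : WeierstrassCurve ℚ) (K : Type) [Field K] [NumberField K],
      kolyvagin N W K)
    (hSk : Skinner2016.thmC_padicValRat_bsd_rank_zero)
    (hGZK : rank_eq_analyticRank_of_analyticRank_le_one) (hmod : hasEntireLFunction_rat)
    (h331 : JetchevSkinnerWan2017.thm331_anticyclotomicControl_mult)
    (hS : ∀ (W : WeierstrassCurve ℚ) [W.IsElliptic] [W.IsGloballyMinimal] [NeZero (W.conductorNorm ℤ)]
      (p : ℕ) [Fact p.Prime], ClassX11b W p → 5 ≤ p → Rank1Residual.Surj W p → Rank1Residual.Ram W p →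
      (∃ P : (W.baseChange ℚ_[p]).toAffine.Point, p • P = 0 ∧ P ≠ 0) →
      ∃ (K : Type) (_ : Field K) (_ : NumberField K)
        (Dt : ModularParametrizationData W (W.conductorNorm ℤ))
        (H : HeegnerDatum (W.conductorNorm ℤ) (NumberField.discr K)) (ι : K →+* ℂ)
        (P : (W.baseChange K).toAffine.Point),
        IsImaginaryQuadratic K ∧ Odd (NumberField.discr K) ∧ NumberField.discr K < -4 ∧
          SatisfiesHeegnerHypothesis (W.conductorNorm ℤ) K ∧
          WeierstrassCurve.Affine.Point.map ι.toRatAlgHom P = heegnerPointComplex Dt H ∧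
          ¬ (p : ℤ) ∣ Dt.c ∧ ¬ IsOfFinAddOrder P ∧
          padicValNat p (AddSubgroup.zmultiples P).index ≤ padicValNat p W.tamagawaProduct) :
    Summit.BirchSwinnertonDyer.BirchSwinnertonDyer.Theses.ErratumRoadFive.Rest3TorsionBranchAtFive := by
  intro W _ _ p hp hram hP
  refine p2OpenInputOnTreeAt_of_imp_surj W p fun hX hp5 hs ↦ ?_
  haveI : NeZero (W.conductorNorm ℤ) := ⟨(W.conductorNorm_pos_holds).ne'⟩
  exact openInputOnTreeAt_of_exists_slackDatum_of_thm331Mult W p hGZ hKo hSk hGZK hmod h331 hX hram (hS W p hX hp5 hs hram hP)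

/-- **(T) BY THE ROUTE'S NAMES ⟸ slack data**: `PublishedInputsFive` (19066) + `JSWAnticyclotomicControlMult` (19626) + `hS` on the (T)
rows ⟹ `Rest3TorsionBranchAtFive`. CONDITIONAL; nothing booked. [cite: Gross1991, (1.1), (2.2)] [cite: JetchevSkinnerWan2017, Thm. 3.3.1] -/
theorem rest3TorsionBranchAtFive_of_publishedInputsFive_of_slackData
    (hF : PublishedInputsFive) (h331 : JSWAnticyclotomicControlMult)
    (hS : ∀ (W : WeierstrassCurve ℚ) [W.IsElliptic] [W.IsGloballyMinimal] [NeZero (W.conductorNorm ℤ)]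
      (p : ℕ) [Fact p.Prime], ClassX11b W p → 5 ≤ p → Rank1Residual.Surj W p → Rank1Residual.Ram W p →
      (∃ P : (W.baseChange ℚ_[p]).toAffine.Point, p • P = 0 ∧ P ≠ 0) →
      ∃ (K : Type) (_ : Field K) (_ : NumberField K)
        (Dt : ModularParametrizationData W (W.conductorNorm ℤ))
        (H : HeegnerDatum (W.conductorNorm ℤ) (NumberField.discr K)) (ι : K →+* ℂ)
        (P : (W.baseChange K).toAffine.Point),
        IsImaginaryQuadratic K ∧ Odd (NumberField.discr K) ∧ NumberField.discr K < -4 ∧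
          SatisfiesHeegnerHypothesis (W.conductorNorm ℤ) K ∧
          WeierstrassCurve.Affine.Point.map ι.toRatAlgHom P = heegnerPointComplex Dt H ∧
          ¬ (p : ℤ) ∣ Dt.c ∧ ¬ IsOfFinAddOrder P ∧
          padicValNat p (AddSubgroup.zmultiples P).index ≤ padicValNat p W.tamagawaProduct) :
    Summit.BirchSwinnertonDyer.BirchSwinnertonDyer.Theses.ErratumRoadFive.Rest3TorsionBranchAtFive := by
  obtain ⟨hGZ, hKo, -, hSk, -, hGZK, hmod, -, -, -, -, -, -, -, -⟩ := hF
  exact rest3TorsionBranchAtFive_of_slackData_of_thm331Mult hGZ hKo hSk hGZK hmod h331 hS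

/-- **`stub_nw_offLocus` (crux 19703, registered signature VERBATIM) ⟸ Tamagawa-slack Heegner data on the (NW) ∩ off-Locus rows.**
The published named facts, `h331` and `hS`: at every X11b pair with `p ≥ 5`, `ρ̄` onto, a (ram) witness, `E(ℚ_p)[p] = 0`, no odd non-split
`E[p]`-ramified multiplicative `q ≠ p`, and `p ∣ ∏ c_ℓ` (cw 18 793 pairs `N < 5·10⁵`), ONE odd Heegner datum with `d_K < −4`, `p ∤ c`,
non-torsion Heegner point and `ord_p [E(K):ℤP] ≤ ord_p ∏_ℓ c_ℓ(E)`. The slack twin of nw1's `stub_nw_offLocus_of_kolyvaginTamFramesHL_of_thm331Mult`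
(there: a class-wide ♯-hypothesis `hZt`; here: a per-pair certificate currency). CONDITIONAL; nothing booked.
[cite: Gross1991, (1.1), Thm. 1.3, (2.2)] [cite: JetchevSkinnerWan2017, Thm. 3.3.1, §7.4.1] [cite: Skinner2016PacificMC, Thm. C (§1)]
[cite: Castella2018Erratum, Thm. 1.1 (iii)–(iv)] -/
theorem nwOffLocus_of_slackData_of_thm331Mult
    (hGZ : ∀ (N : ℕ) [NeZero N] (W : WeierstrassCurve ℚ) (K : Type) [Field K] [NumberField K],
      gross_zagier N W K)
    (hKo : ∀ (N : ℕ) [NeZero N] (W : WeierstrassCurve ℚ) (K : Type) [Field K] [NumberField K],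
      kolyvagin N W K)
    (hSk : Skinner2016.thmC_padicValRat_bsd_rank_zero)
    (hGZK : rank_eq_analyticRank_of_analyticRank_le_one) (hmod : hasEntireLFunction_rat)
    (h331 : JetchevSkinnerWan2017.thm331_anticyclotomicControl_mult)
    (hS : ∀ (W : WeierstrassCurve ℚ) [W.IsElliptic] [W.IsGloballyMinimal] [NeZero (W.conductorNorm ℤ)]
      (p : ℕ) [Fact p.Prime], ClassX11b W p → 5 ≤ p → Rank1Residual.Surj W p → Rank1Residual.Ram W p →
      (∀ P : (W.baseChange ℚ_[p]).toAffine.Point, p • P = 0 → P = 0) →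
      ¬ (∃ (q : ℕ) (_ : Fact q.Prime), q ≠ 2 ∧ q ≠ p ∧ Rank1Residual.Mult W q ∧
          ¬ W.HasSplitMultiplicativeReductionAtPrime q ∧ ¬ p ∣ padicValInt q W.minimalDiscriminantInt) →
      p ∣ W.tamagawaProduct →
      ∃ (K : Type) (_ : Field K) (_ : NumberField K)
        (Dt : ModularParametrizationData W (W.conductorNorm ℤ))
        (H : HeegnerDatum (W.conductorNorm ℤ) (NumberField.discr K)) (ι : K →+* ℂ)
        (P : (W.baseChange K).toAffine.Point),
        IsImaginaryQuadratic K ∧ Odd (NumberField.discr K) ∧ NumberField.discr K < -4 ∧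
          SatisfiesHeegnerHypothesis (W.conductorNorm ℤ) K ∧
          WeierstrassCurve.Affine.Point.map ι.toRatAlgHom P = heegnerPointComplex Dt H ∧
          ¬ (p : ℤ) ∣ Dt.c ∧ ¬ IsOfFinAddOrder P ∧
          padicValNat p (AddSubgroup.zmultiples P).index ≤ padicValNat p W.tamagawaProduct) :
    ∀ (W : WeierstrassCurve ℚ) [W.IsElliptic] [W.IsGloballyMinimal] (p : ℕ) [Fact p.Prime],
      Literature.NumberTheory.EllipticCurves.Rank1Residual.Ram W p →
      (∀ P : (W.baseChange ℚ_[p]).toAffine.Point, p • P = 0 → P = 0) →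
      ¬ (∃ (q : ℕ) (_ : Fact q.Prime), q ≠ 2 ∧ q ≠ p ∧ Literature.NumberTheory.EllipticCurves.Rank1Residual.Mult W q ∧
          ¬ W.HasSplitMultiplicativeReductionAtPrime q ∧ ¬ p ∣ padicValInt q W.minimalDiscriminantInt) →
      p ∣ W.tamagawaProduct →
      Summit.BirchSwinnertonDyer.Rank1Residual.X11b.P2OpenInputOnTreeAt W p := by
  intro W _ _ p hp hram htf hnw htam
  refine p2OpenInputOnTreeAt_of_imp_surj W p fun hX hp5 hs ↦ ?_
  haveI : NeZero (W.conductorNorm ℤ) := ⟨(W.conductorNorm_pos_holds).ne'⟩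
  exact openInputOnTreeAt_of_exists_slackDatum_of_thm331Mult W p hGZ hKo hSk hGZK hmod h331 hX hram
    (hS W p hX hp5 hs hram htf hnw htam)

/-- **`stub_nw_offLocus` BY THE ROUTE'S NAMES ⟸ slack data**: `PublishedInputsFive` + `JSWAnticyclotomicControlMult` + `hS` on the
(NW) ∩ off-Locus rows ⟹ the registered statement of `stub_nw_offLocus`. CONDITIONAL; nothing booked.
[cite: Gross1991, (1.1), (2.2)] [cite: JetchevSkinnerWan2017, Thm. 3.3.1] -/
theorem nwOffLocus_of_publishedInputsFive_of_slackData
    (hF : PublishedInputsFive) (h331 : JSWAnticyclotomicControlMult)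
    (hS : ∀ (W : WeierstrassCurve ℚ) [W.IsElliptic] [W.IsGloballyMinimal] [NeZero (W.conductorNorm ℤ)]
      (p : ℕ) [Fact p.Prime], ClassX11b W p → 5 ≤ p → Rank1Residual.Surj W p → Rank1Residual.Ram W p →
      (∀ P : (W.baseChange ℚ_[p]).toAffine.Point, p • P = 0 → P = 0) →
      ¬ (∃ (q : ℕ) (_ : Fact q.Prime), q ≠ 2 ∧ q ≠ p ∧ Rank1Residual.Mult W q ∧
          ¬ W.HasSplitMultiplicativeReductionAtPrime q ∧ ¬ p ∣ padicValInt q W.minimalDiscriminantInt) →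
      p ∣ W.tamagawaProduct →
      ∃ (K : Type) (_ : Field K) (_ : NumberField K)
        (Dt : ModularParametrizationData W (W.conductorNorm ℤ))
        (H : HeegnerDatum (W.conductorNorm ℤ) (NumberField.discr K)) (ι : K →+* ℂ)
        (P : (W.baseChange K).toAffine.Point),
        IsImaginaryQuadratic K ∧ Odd (NumberField.discr K) ∧ NumberField.discr K < -4 ∧
          SatisfiesHeegnerHypothesis (W.conductorNorm ℤ) K ∧
          WeierstrassCurve.Affine.Point.map ι.toRatAlgHom P = heegnerPointComplex Dt H ∧
          ¬ (p : ℤ) ∣ Dt.c ∧ ¬ IsOfFinAddOrder P ∧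
          padicValNat p (AddSubgroup.zmultiples P).index ≤ padicValNat p W.tamagawaProduct) :
    ∀ (W : WeierstrassCurve ℚ) [W.IsElliptic] [W.IsGloballyMinimal] (p : ℕ) [Fact p.Prime],
      Literature.NumberTheory.EllipticCurves.Rank1Residual.Ram W p →
      (∀ P : (W.baseChange ℚ_[p]).toAffine.Point, p • P = 0 → P = 0) →
      ¬ (∃ (q : ℕ) (_ : Fact q.Prime), q ≠ 2 ∧ q ≠ p ∧ Literature.NumberTheory.EllipticCurves.Rank1Residual.Mult W q ∧
          ¬ W.HasSplitMultiplicativeReductionAtPrime q ∧ ¬ p ∣ padicValInt q W.minimalDiscriminantInt) →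
      p ∣ W.tamagawaProduct →
      Summit.BirchSwinnertonDyer.Rank1Residual.X11b.P2OpenInputOnTreeAt W p := by
  obtain ⟨hGZ, hKo, -, hSk, -, hGZK, hmod, -, -, -, -, -, -, -, -⟩ := hF
  exact nwOffLocus_of_slackData_of_thm331Mult hGZ hKo hSk hGZK hmod h331 hS

end Summit.BirchSwinnertonDyer.BirchSwinnertonDyer.Theorems

end
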